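import Literature.AlgebraicGeometry.HodgeTheory.CotangentSheafPullbackHomCharts
import Literature.AlgebraicGeometry.Motives.DifferentialsProofs
import HarnessLib

/-!
# A derivation of `Γ(V, 𝒪_X)` along a ring map `φ : Γ(V, 𝒪_X) → R` factors through `Γ(V, Ω¹_{X/S})` on an affine open
# (Hartshorne II.8: `Der_S(B, M) = Hom_B(Ω_{B/S}, M)` with `Γ(V, Ω¹) = Ω_{Γ(V)/S}`, II Remark 8.9.2)

Layer `Literature/AlgebraicGeometry/HodgeTheory`, namespace `Literature.AlgebraicGeometry.HodgeTheory` (THEOREMS only: no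
definition, no instance, no notation, no named fact).  Companion of ★ `TangentSheafSectionsDerivations` (K1: derivations of
`Γ(V, 𝒪_X)` INTO ITSELF are the sections of the tangent sheaf over an affine `V`).  Here the values lie in an ARBITRARY
commutative ring `R` made a `Γ(V, 𝒪_X)`-module by a ring map `φ : Γ(V, 𝒪_X) → R` — the case of record is `R = Γ(f⁻¹V, 𝒪_Y)`,
`φ = f♯` for a morphism `f : Y → X` (a «`f♯`-derivation», e.g. the DEFECT of two chart lifts of `f` intertwining lifted gluing
data modulo a square-zero ideal, ★ `Deformation/SmoothSchemeLiftObstructionFunctorialThreeLifts.defect₂_mul`):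

* **`exists_semilinear_lift_of_leibniz`** — every additive `δ : Γ(V, 𝒪_X) → R` with `δ(ab) = φ(a)δ(b) + φ(b)δ(a)` and
  `δ|_S = 0` is `a ↦ ℓ(da)` for an additive `ℓ : Γ(V, Ω¹_{X/S}) → R` which is `φ`-SEMILINEAR, `ℓ(r • ω) = φ(r) ℓ(ω)`
  (universal property of `Ω_{Γ(V)/S}`, Mathlib `Derivation.liftKaehlerDifferential`, transported along the tree's
  `Γ(V, Ω¹) = Ω_{Γ(V)/S}`, ★ `Motives.bijective_toCotangentSheaf_app_holds`);
* **`semilinear_ext_dSection`** — two `φ`-semilinear additive maps `Γ(V, Ω¹_{X/S}) → R` agreeing on the exact forms `da`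
  agree (★ `span_range_dSection_eq_top`: `Γ(V, Ω¹) = Γ(V, 𝒪)·dΓ(V, 𝒪)`), hence `existsUnique_semilinear_lift_of_leibniz`.

Cell `hodgecm-mathlib` (D-0151), F-11 α1 / J4-(iv) brick (iv-1b) (Čech functoriality of the obstruction class, B-p08 (g16)): the
defect cochain of chartwise-lifted morphisms is read on global `1`-forms through these `ℓ`.  Count-neutral generic capital.
HC_CM is proved only modulo the 7 printed citations until rung 0 closes — nothing here bears on a summit statement.

## References
* [Hartshorne1977] R. Hartshorne, *Algebraic Geometry*, GTM 52 (1977): II.8 p. 172 (`Der_A(B, M) = Hom_B(Ω_{B/A}, M)`),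
  II Remark 8.9.2 (p. 175), II Prop. 5.2 (p. 110).
-/

noncomputable section

open CategoryTheory AlgebraicGeometry Opposite TopologicalSpace

universe u

namespace Literature.AlgebraicGeometry.HodgeTheory

open Literature.AlgebraicGeometry.Modules Literature.AlgebraicGeometry.Motives

variable {S : Type u} [CommRing S] {X : Over (Spec (CommRingCat.of S))} {V : X.left.Opens}
  {R : Type u} [CommRing R] (φ : Γ(X.left, V) →+* R)

/-- **Uniqueness: a `φ`-semilinear additive map out of `Γ(V, Ω¹_{X/S})` is determined by its values on the exact forms `da`**
(`V` affine: `Γ(V, Ω¹)` is spanned over `Γ(V, 𝒪)` by the `da`, ★ `span_range_dSection_eq_top`).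
[cite: Hartshorne1977, II Remark 8.9.2 (p. 175) and II.8 p. 172] -/
theorem semilinear_ext_dSection (hV : IsAffineOpen V) {ℓ ℓ' : Γ(cotangentSheaf X, V) →+ R}
    (hℓ : ∀ (r : Γ(X.left, V)) (ω : Γ(cotangentSheaf X, V)), ℓ (r • ω) = φ r * ℓ ω)
    (hℓ' : ∀ (r : Γ(X.left, V)) (ω : Γ(cotangentSheaf X, V)), ℓ' (r • ω) = φ r * ℓ' ω)
    (h : ∀ a : Γ(X.left, V), ℓ (dSection X V a) = ℓ' (dSection X V a)) : ℓ = ℓ' := by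
  ext ω
  have hω : ω ∈ Submodule.span Γ(X.left, V) (Set.range (dSection X V)) := by
    rw [span_range_dSection_eq_top X hV]
    exact Submodule.mem_top
  induction hω using Submodule.span_induction with
  | mem x hx =>
    obtain ⟨a, rfl⟩ := hx
    exact h a
  | zero => rw [map_zero, map_zero]
  | add x y _ _ hx hy => rw [map_add, map_add, hx, hy]
  | smul r x _ hx => rw [hℓ, hℓ', hx]

/-- **EXISTENCE: a `φ`-derivation factors through `d : Γ(V, 𝒪) → Γ(V, Ω¹)` on an affine open.**  For `δ : Γ(V, 𝒪_X) → R`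
additive with `δ(ab) = φ(a) δ(b) + φ(b) δ(a)` and `δ(s · 1) = 0` (`s ∈ S`), there is an additive `φ`-semilinear
`ℓ : Γ(V, Ω¹_{X/S}) → R` with `ℓ(da) = δ(a)` (universal property of `Ω_{Γ(V)/S}` = `Γ(V, Ω¹)` for `V` affine).
[cite: Hartshorne1977, II.8 p. 172 (`Hom_B(Ω_{B/A}, M) = Der_A(B, M)`)] [cite: Hartshorne1977, II Remark 8.9.2 (p. 175)] -/
theorem exists_semilinear_lift_of_leibniz (hV : IsAffineOpen V) (δ : Γ(X.left, V) → R)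
    (hadd : ∀ a b, δ (a + b) = δ a + δ b) (hmul : ∀ a b, δ (a * b) = φ a * δ b + φ b * δ a)
    (hconst : ∀ s : S, δ ((constToPresheaf X).app (op V) s) = 0) :
    ∃ ℓ : Γ(cotangentSheaf X, V) →+ R,
      (∀ (r : Γ(X.left, V)) (ω : Γ(cotangentSheaf X, V)), ℓ (r • ω) = φ r * ℓ ω) ∧
        ∀ a : Γ(X.left, V), ℓ (dSection X V a) = δ a := by
  classical
  letI algV : Algebra S Γ(X.left, V) :=
    (((constToPresheaf X).app (op V)).hom : S →+* Γ(X.left, V)).toAlgebra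
  have halg : ∀ s : S, algebraMap S Γ(X.left, V) s = (constToPresheaf X).app (op V) s := fun _ => rfl
  -- `R` as a `Γ(V)`-algebra through `φ`, and as an `S`-algebra through `φ ∘ (S → Γ(V))`
  letI algR : Algebra Γ(X.left, V) R := φ.toAlgebra
  letI algSR : Algebra S R := (φ.comp (algebraMap S Γ(X.left, V))).toAlgebra
  haveI : IsScalarTower S Γ(X.left, V) R :=
    IsScalarTower.of_algebraMap_eq (fun s => rfl)
  have hφ : ∀ (r : Γ(X.left, V)) (x : R), r • x = φ r * x := fun _ _ => rfl
  -- `δ` as an `S`-derivation of `B = Γ(V, 𝒪_X)` with values in `R`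
  let δₗ : Γ(X.left, V) →ₗ[S] R :=
    { toFun := δ
      map_add' := hadd
      map_smul' := fun s a => by
        rw [RingHom.id_apply, Algebra.smul_def, hmul, halg, hconst, mul_zero, add_zero, Algebra.smul_def]
        rfl }
  let D : Derivation S Γ(X.left, V) R :=
    Derivation.mk' δₗ fun a b => by
      change δ (a * b) = a • δ b + b • δ a
      rw [hφ, hφ]
      exact hmul a b
  have hD : ∀ a, D a = δ a := fun _ => rfl
  have hL₀ : ∀ a, D.liftKaehlerDifferential (KaehlerDifferential.D S Γ(X.left, V) a) = δ a := fun a => by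
    rw [Derivation.liftKaehlerDifferential_comp_D, hD]
  -- transport along the bijection `e : Ω_{B/S} → Γ(V, Ω¹)`
  let e : Ω[Γ(X.left, V)⁄S] → Γ(cotangentSheaf X, V) := fun ζ => (toCotangentSheaf X).app (op V) ζ
  have he_add : ∀ ζ ζ' : Ω[Γ(X.left, V)⁄S], e (ζ + ζ') = e ζ + e ζ' := fun ζ ζ' =>
    ((toCotangentSheaf X).app (op V)).hom.map_add ζ ζ'
  have he_smul : ∀ (r : Γ(X.left, V)) (ζ : Ω[Γ(X.left, V)⁄S]), e (r • ζ) = r • e ζ := fun r ζ =>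
    ((toCotangentSheaf X).app (op V)).hom.map_smul r ζ
  have he_d : ∀ a : Γ(X.left, V), e (KaehlerDifferential.D S Γ(X.left, V) a) = dSection X V a := fun _ => rfl
  have hbij : Function.Bijective e := bijective_toCotangentSheaf_app_holds X hV
  obtain ⟨g, hlg, hrg⟩ := Function.bijective_iff_has_inverse.mp hbij
  have hrg' : ∀ ω, e (g ω) = ω := hrg
  have hg_add : ∀ ω ω' : Γ(cotangentSheaf X, V), g (ω + ω') = g ω + g ω' := fun ω ω' =>
    hbij.1 (by rw [hrg', he_add, hrg', hrg'])
  have hg_smul : ∀ (r : Γ(X.left, V)) (ω : Γ(cotangentSheaf X, V)), g (r • ω) = r • g ω := fun r ω =>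
    hbij.1 (by rw [hrg', he_smul, hrg'])
  have hg_d : ∀ a : Γ(X.left, V), g (dSection X V a) = KaehlerDifferential.D S Γ(X.left, V) a := fun a =>
    hbij.1 (by rw [hrg', he_d])
  have hg_zero : g 0 = 0 := hbij.1 (by rw [hrg']; exact (((toCotangentSheaf X).app (op V)).hom.map_zero).symm)
  let ℓ : Γ(cotangentSheaf X, V) →+ R :=
    { toFun := fun ω => D.liftKaehlerDifferential (g ω)
      map_zero' := by
        change D.liftKaehlerDifferential (g 0) = 0
        rw [hg_zero, map_zero]
      map_add' := fun ω ω' => by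
        change D.liftKaehlerDifferential (g (ω + ω')) = D.liftKaehlerDifferential (g ω) + D.liftKaehlerDifferential (g ω')
        rw [hg_add, map_add] }
  refine ⟨ℓ, fun r ω => ?_, fun a => ?_⟩
  · change D.liftKaehlerDifferential (g (r • ω)) = φ r * D.liftKaehlerDifferential (g ω)
    rw [hg_smul, map_smul, hφ]
  · change D.liftKaehlerDifferential (g (dSection X V a)) = δ a
    rw [hg_d, hL₀]

/-- **`Der_S(Γ(V, 𝒪_X), R) = Hom^{φ}_{Γ(V)}(Γ(V, Ω¹_{X/S}), R)` on an affine open `V`**: existence and uniqueness of the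
`φ`-semilinear lift. [cite: Hartshorne1977, II.8 p. 172 and II Remark 8.9.2 (p. 175)] -/
theorem existsUnique_semilinear_lift_of_leibniz (hV : IsAffineOpen V) (δ : Γ(X.left, V) → R)
    (hadd : ∀ a b, δ (a + b) = δ a + δ b) (hmul : ∀ a b, δ (a * b) = φ a * δ b + φ b * δ a)
    (hconst : ∀ s : S, δ ((constToPresheaf X).app (op V) s) = 0) :
    ∃! ℓ : Γ(cotangentSheaf X, V) →+ R,
      (∀ (r : Γ(X.left, V)) (ω : Γ(cotangentSheaf X, V)), ℓ (r • ω) = φ r * ℓ ω) ∧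
        ∀ a : Γ(X.left, V), ℓ (dSection X V a) = δ a := by
  obtain ⟨ℓ, hℓ, hℓd⟩ := exists_semilinear_lift_of_leibniz φ hV δ hadd hmul hconst
  refine ⟨ℓ, ⟨hℓ, hℓd⟩, fun ℓ' hℓ' => semilinear_ext_dSection φ hV hℓ'.1 hℓ fun a => ?_⟩
  rw [hℓ'.2, hℓd]

end Literature.AlgebraicGeometry.HodgeTheory

end
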